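import Mathlib
import Literature.Probability.LatticeModels.SphereReflectionPositivityNecessity

/-!
# Route SAWTowerCount · support `PoissonKernelExpansion` — elementary helper bounds

Helper lemmas for the proof of
`Summit.CriticalPhenomena.SAWScalingLimit.Theses.SAWTowerCount.PoissonKernelExpansion`
(item stmt-CriticalPhenomena-7258):

* `inv_sinh_eq_exp` and the three bounds `inv_sinh_le`, `abs_inv_sinh_sub_le`,
  `abs_inv_sinh_sub_sub_le`: for `x > 0` with `exp(-x)^2 ≤ 1/2`,
  `1/sinh x = 2t/(1-t²) = 2t + 2t³ + O(t⁵)` where `t = exp(-x)`, with explicit constant `4`;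
* `one_add_rpow_taylor_two`: `(1+u)^b = 1 + b u + b(b-1)/2 · u² + O(|u|³)` near `u = 0`, the
  `ε–δ` form of `Literature.Probability.LatticeModels.isBigO_one_add_rpow_sub_taylor_two`
  (Mathlib's binomial series `Real.one_add_rpow_hasFPowerSeriesOnBall_zero`);
* `two_mul_le_sin_pi_mul`: `2η ≤ sin(π y)` for `y ∈ [η, 1-η]` (Jordan's inequality `Real.mul_le_sin`).

All statements are folklore calculus; no literature facts are used.
-/

namespace Summit.CriticalPhenomena.SAWScalingLimit.Theorems

open Real

/-- Second-order Taylor expansion of `u ↦ (1+u)^b` at `0` with an `O(|u|³)` remainder, uniform on a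
neighbourhood of `0`: there are `C` and `δ > 0` with
`|(1+u)^b - (1 + b u + b(b-1)/2 u²)| ≤ C |u|³` for `|u| < δ`.  An `ε–δ` unpacking of the tree's
`Literature.Probability.LatticeModels.isBigO_one_add_rpow_sub_taylor_two` (binomial series). -/
theorem one_add_rpow_taylor_two (b : ℝ) : ∃ C δ : ℝ, 0 < δ ∧ ∀ u : ℝ, |u| < δ →
    |(1 + u) ^ b - (1 + b * u + b * (b - 1) / 2 * u ^ 2)| ≤ C * |u| ^ 3 := by
  have h := Literature.Probability.LatticeModels.isBigO_one_add_rpow_sub_taylor_two b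
  rw [Asymptotics.isBigO_iff] at h
  obtain ⟨C, hC⟩ := h
  rw [Metric.eventually_nhds_iff] at hC
  obtain ⟨δ, hδ, hδC⟩ := hC
  refine ⟨C, δ, hδ, fun u hu => ?_⟩
  have := hδC (y := u) (by simpa [Real.dist_eq] using hu)
  simpa only [Real.norm_eq_abs, abs_pow, abs_abs] using this

/-- For `x > 0`, `1 / sinh x = 2 e^{-x} / (1 - e^{-2x})`. -/
theorem inv_sinh_eq_exp {x : ℝ} (hx : 0 < x) :
    (Real.sinh x)⁻¹ = 2 * Real.exp (-x) / (1 - Real.exp (-x) ^ 2) := by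
  have ht0 : 0 < Real.exp (-x) := Real.exp_pos _
  have ht1 : Real.exp (-x) < 1 := Real.exp_lt_one_iff.mpr (by linarith)
  have hD : 0 < 1 - Real.exp (-x) ^ 2 := by nlinarith
  have hsinh : Real.sinh x = (1 - Real.exp (-x) ^ 2) / (2 * Real.exp (-x)) := by
    rw [Real.sinh_eq, Real.exp_neg]
    have hE : Real.exp x ≠ 0 := (Real.exp_pos x).ne'
    field_simp
  rw [hsinh, inv_div]

/-- Auxiliary: if `0 < t` and `t² ≤ 1/2` then `2 tⁿ / (1 - t²) ≤ 4 tⁿ` and it is nonnegative. -/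
theorem two_mul_pow_div_le {t : ℝ} (ht : 0 < t) (ht2 : t ^ 2 ≤ 1 / 2) (n : ℕ) :
    0 ≤ 2 * t ^ n / (1 - t ^ 2) ∧ 2 * t ^ n / (1 - t ^ 2) ≤ 4 * t ^ n := by
  have hD : 1 / 2 ≤ 1 - t ^ 2 := by linarith
  have hD0 : 0 < 1 - t ^ 2 := by linarith
  have htn : 0 ≤ t ^ n := pow_nonneg ht.le n
  refine ⟨div_nonneg (by positivity) hD0.le, ?_⟩
  rw [div_le_iff₀ hD0]
  nlinarith

/-- For `x > 0` with `e^{-2x} ≤ 1/2`: `0 < 1/sinh x ≤ 4 e^{-x}`. -/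
theorem inv_sinh_le {x : ℝ} (hx : 0 < x) (h2 : Real.exp (-x) ^ 2 ≤ 1 / 2) :
    0 < (Real.sinh x)⁻¹ ∧ (Real.sinh x)⁻¹ ≤ 4 * Real.exp (-x) := by
  refine ⟨inv_pos.mpr (Real.sinh_pos_iff.mpr hx), ?_⟩
  rw [inv_sinh_eq_exp hx]
  have := (two_mul_pow_div_le (Real.exp_pos (-x)) h2 1).2
  simpa using this

/-- For `x > 0` with `e^{-2x} ≤ 1/2`: `|1/sinh x - 2e^{-x}| ≤ 4 e^{-3x}`. -/
theorem abs_inv_sinh_sub_le {x : ℝ} (hx : 0 < x) (h2 : Real.exp (-x) ^ 2 ≤ 1 / 2) :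
    |(Real.sinh x)⁻¹ - 2 * Real.exp (-x)| ≤ 4 * Real.exp (-x) ^ 3 := by
  rw [inv_sinh_eq_exp hx]
  set t := Real.exp (-x) with ht
  have ht0 : 0 < t := Real.exp_pos _
  have hD0 : 0 < 1 - t ^ 2 := by linarith
  have hid : 2 * t / (1 - t ^ 2) - 2 * t = 2 * t ^ 3 / (1 - t ^ 2) := by
    field_simp
    ring
  rw [hid]
  obtain ⟨h0, h4⟩ := two_mul_pow_div_le ht0 h2 3
  rw [abs_of_nonneg h0]
  exact h4

/-- For `x > 0` with `e^{-2x} ≤ 1/2`: `|1/sinh x - 2e^{-x} - 2e^{-3x}| ≤ 4 e^{-5x}`. -/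
theorem abs_inv_sinh_sub_sub_le {x : ℝ} (hx : 0 < x) (h2 : Real.exp (-x) ^ 2 ≤ 1 / 2) :
    |(Real.sinh x)⁻¹ - 2 * Real.exp (-x) - 2 * Real.exp (-x) ^ 3| ≤ 4 * Real.exp (-x) ^ 5 := by
  rw [inv_sinh_eq_exp hx]
  set t := Real.exp (-x) with ht
  have ht0 : 0 < t := Real.exp_pos _
  have hD0 : 0 < 1 - t ^ 2 := by linarith
  have hid : 2 * t / (1 - t ^ 2) - 2 * t - 2 * t ^ 3 = 2 * t ^ 5 / (1 - t ^ 2) := by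
    field_simp
    ring
  rw [hid]
  obtain ⟨h0, h4⟩ := two_mul_pow_div_le ht0 h2 5
  rw [abs_of_nonneg h0]
  exact h4

/-- Jordan-type lower bound: for `0 ≤ η ≤ y ≤ 1 - η` one has `2η ≤ sin(π y)`. -/
theorem two_mul_le_sin_pi_mul {η y : ℝ} (hη : 0 ≤ η) (h1 : η ≤ y) (h2 : y ≤ 1 - η) :
    2 * η ≤ Real.sin (Real.pi * y) := by
  have hpi := Real.pi_pos
  rcases le_total y (1 / 2) with hy | hy
  · have hx0 : 0 ≤ Real.pi * y := by nlinarith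
    have hx1 : Real.pi * y ≤ Real.pi / 2 := by nlinarith
    have := Real.mul_le_sin hx0 hx1
    calc 2 * η ≤ 2 * y := by linarith
      _ = 2 / Real.pi * (Real.pi * y) := by field_simp
      _ ≤ _ := this
  · have hrw : Real.pi * y = Real.pi - Real.pi * (1 - y) := by ring
    rw [hrw, Real.sin_pi_sub]
    have hx0 : 0 ≤ Real.pi * (1 - y) := by nlinarith
    have hx1 : Real.pi * (1 - y) ≤ Real.pi / 2 := by nlinarith
    have := Real.mul_le_sin hx0 hx1
    calc 2 * η ≤ 2 * (1 - y) := by linarith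
      _ = 2 / Real.pi * (Real.pi * (1 - y)) := by field_simp
      _ ≤ _ := this

/-- `exp(-(k+1) a m) = exp(-a m)^(k+1)` in the form the Poisson-kernel series uses. -/
theorem exp_neg_succ_mul (k : ℕ) (a m : ℝ) :
    Real.exp (-(((k : ℝ) + 1) * a * m)) = Real.exp (-a * m) ^ (k + 1) := by
  rw [← Real.exp_nat_mul]
  congr 1
  push_cast
  ring

end Summit.CriticalPhenomena.SAWScalingLimit.Theorems
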